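/-
Copyright: lit-balaban Phase-2 proof seat p08 (gen 9).  Statement-level skeleton of a published paper; no proof claims beyond what
the kernel checks below.
-/
import Literature.MathematicalPhysics.QuantumFieldTheory.BalabanImbrieJaffe1984to88.BIJ88CkLoc226Torus
import Literature.MathematicalPhysics.QuantumFieldTheory.BalabanImbrieJaffe1984to88.BIJ88Sect2SigmaAllTori
import Literature.MathematicalPhysics.QuantumFieldTheory.BalabanImbrieJaffe1984to88.BIJ85Prop12PerTower

/-!
# `BalabanImbrieJaffe1984to88.BIJ88Decay223CkAllTori` — T. Bałaban, J. Imbrie, A. Jaffe, *Effective action and cluster properties of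
the abelian Higgs model*, Commun. Math. Phys. **114** (1988) 257–315 [BalabanImbrieJaffe1988], Sect. 2 p. 262 [PDF 6]: **(2.23), (2.25)
AND (2.26) FOR THE `C_k` OF RECORD — HYPOTHESIS-FREE PER TORUS, AND WITH CONSTANTS CHOSEN BEFORE THE TORUS** given [6I] Proposition 1.2
by its tree name over the ALL-TORI index: the quantifier bookkeeping of p08 g8's `BIJ88Decay223CkTorus` / `BIJ88CkLoc226Torus` along
p16's all-tori (7.2.2) (`BIJ85Sect72AllTori`, `BIJ88Sect2SigmaAllTori`).

statement-level skeleton of published theorems with citation tags; proofs where landed; nothing here is a claim about the Yang–Mills mass gap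

PDF held: `paper:balaban1988-cmp114-bij-abelian-higgs-effective-action` (journal page = PDF page + 256), p. 262 [PDF 6]; [I] =
[BalabanImbrieJaffe1985] p. 325 [PDF 27] (7.2.2); [6I] = [Balaban1984PropagatorsI] Prop. 1.2 p. 35 *"independent of k, T_η"* (tree name
`Balaban1983to89.B5.Prop12Printed`).

CITATION HEADER (lean-in-tree rule).  Part of the lit-balaban TYPED SKELETON (HOME `run/shared/lean/pub/lit-balaban/`), Phase-2 proof
seat p08 (gen 9), unit `lit-balaban-p08`; free-target protocol G.5-34(d), TAKING line HOME/STATUS.md 2026-08-21T21:5xZ — the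
(2.23)/(2.26) all-tori slot explicitly left free by p16 g7 (HOME/lit-balaban-r18/INBOX.md 21:13:58Z) and r18 g10 (seat INBOX 21:17:51Z).
WHAT IS REPRODUCED = SKELETON rows **C2.Eq2.23**, **C2.Eq2.25**, **C2.Eq2.26** (owner r18, referee ref-5; heads `proved`), kind «model
instance» for the `C_k` of record `BIJ88Eq220Torus.CkE` (p08 g7) and its localization `loc ζ′_k C_k` with p13's (2.24) cutoff, in the two
quantifier shapes of typing note G-C1-07 (r18 ROWS-C2 v1.76): PER TORUS with no hypothesis (p16's `prop12Printed_levStd_deltaA`), and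
OVER ALL TORI with ONE set of constants from the all-tori `B5.Prop12Printed`.  Decls used BY NAME (nothing restated): p08 g8's explicit
`BIJ88Decay223CkTorus.abs_CkKernel_le`, `decayFar_of_decay3`, `decay223_Ck_torus_prop12`, `decayFar223_Ck_torus_prop12`,
`BIJ88CkLoc226Torus.decay3_loc`, `close_loc_of_decay3`, `decay223_CkLoc_torus_prop12`, `close226_torus_prop12(_typed)`; p16's
`exists_absH_le_allTori_of_prop12Printed`, `abs_H_zero_le` (sup member, scale `0` = identity), `exists_gradB_allTori_of_prop12Printed`
(gradient member, every `j ≤ m + K`); p09's all-tori (7.2.3) `ineq723_CE_lt`; p13's `cutoff`/`isCutoff_cutoff`; r18's `DecayFar`/`Close`/`loc`.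
Siblings: p16's `decayDk_allTori_of_prop12Printed` (𝒟_k), `BIJ88Sect2SigmaAllTori` (σ_k, (2.16)–(2.19)), r18's `BIJ88Decay216AllTori`,
this seat's `BIJ88Decay213DkLocAllTori` (𝒟_{k,loc}).

THE PRINTED TEXT (p. 262 [PDF 6], verbatim): *"For more distant points, however, the rapid decay of terms with small j controls the
scalings and the sum over j to yield a uniform bound |C_k(x,b′)| ≦ ce^{−c dist(x,b′)}, dist(x,b′) > c. (2.23) … Define C_{k,loc}(x,b′) =
ζ′_k(x,b′)C_k(x,b′). (2.25) Then C_{k,loc} also satisfies (2.23), and |C_{k,loc}(x,b′) − C_k(x,b′)| ≦ e^{−cr(e_k)}e^{−c dist(x,b′)}. (2.26)"*;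
[6I] p. 35: the constants are *"independent of k, T_η"*.

WHAT IS PROVED (0 `sorry`, standard axioms; theorems only — proof lane):
* §1 PER TORUS, NO HYPOTHESIS (`hd : 2 ≤ P.d`, any `a > 0`): **`decay223_Ck_torus`**, `decayFar223_Ck_torus`, **`decay223_CkLoc_torus`**,
  **`close226_torus`**, `close226_torus_typed` — p08 g8's theorems with their `h12` discharged by p16's `prop12Printed_levStd_deltaA`.
* §2 OVER ALL TORI, CONSTANTS BEFORE THE TORUS (`2 ≤ d`, `L` odd `> 1`, all-tori `B5.Prop12Printed`): `exists_HB_allTori_of_prop12Printed`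
  (ONE `(δ, M)` serving both the sup and the gradient member of (7.2.2) on every torus and every `j ≤ m + K`, scale `0` included),
  **`decay223_Ck_allTori_of_prop12Printed`** (ONE `(R₀, c₀, δ′)`: `|C_k(x,b′)| ≤ c₀e^{−δ′dist(x,b′)}` for `dist(x,b′) ≥ R₀` on EVERY torus
  `(P.d = d, P.L = L)` and every `k ≤ m + K`), `decayFar223_Ck_allTori_of_prop12Printed` (r18's one-letter `DecayFar (κ·dist) C_k c`, ONE `(κ, c)`),
  **`decay223_CkLoc_allTori_of_prop12Printed`** ((2.25): the same constants for `C_{k,loc} = loc ζ′_k C_k`, every radius `r`),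
  **`close226_allTori_of_prop12Printed`** ((2.26): ONE `(R₀, c₀, δ′)` with `Close dist C_{k,loc} C_k (c₀e^{−(δ′/2)(r/4)}) (δ′/2)` on every
  torus, every `k ≤ m + K`, every `r ≥ 4R₀`).
HONEST SCOPE.  Pure quantifier bookkeeping; the analysis is p08 g8's `abs_CkKernel_le` (explicit constants in `(M, δ, M_C, δ_C, d)`), the
all-tori inputs are p16's/p09's theorems; the all-tori «[6I] Prop. 1.2 by its tree name» is the hypothesis `h12` of §2 as in the sibling
files (bridge from p37's `prop12_famG_printed`: p19/p30, in flight); readings of `dist(x,b′)` (= p09's `distEU`, units of `T₁^{(k)}`), of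
(2.26)'s `e^{−cr(e_k)}` (= `c₀e^{−(δ′/8)r}` at radius `r`) and the three-constant shapes are those of p08 g8's files.  No `def`, no new named
fact, nothing restated; NOT summit progress.  Unit `lit-balaban-p08` (literature-prover-lit-balaban-p08-g9-0), 2026-08-21.
-/

open scoped BigOperators RealInnerProductSpace

namespace Literature.MathematicalPhysics.QuantumFieldTheory.BalabanImbrieJaffe1984to88.BIJ88Decay223CkAllTori

open Balaban1983to89 hiding Site Plaq
open Balaban1983to89.LatticeFieldCalculus
open BIJ85AxialPropagator411 BIJ85Prop521Torus BIJ85Sigma421Torus BIJ85Prop522Torus BIJ85Sigma422Eta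
open BIJ85Sect7Statements BIJ85Ineq722Torus
open BIJ85Ineq722DeltaA (deltaAData)
open BIJ85Ineq722ProofPart2 (settingOf)
open BIJ88Sect2Statements (DecayFar Close IsCutoff loc)
open BIJ88Cutoffs21 (cutoff cutoff_nonneg cutoff_le_one isCutoff_cutoff)
open BIJ88Eq220Torus (CkE)
open BIJ88Decay223CkTorus (abs_CkKernel_le decayFar_of_decay3 decay223_Ck_torus_prop12 decayFar223_Ck_torus_prop12)
open BIJ88CkLoc226Torus (decay3_loc close_loc_of_decay3 decay223_CkLoc_torus_prop12 close226_torus_prop12 close226_torus_prop12_typed)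
open BIJ85Ineq723TorusCE (ineq723_CE_lt)
open BIJ85Sect72AllTori (exists_absH_le_allTori_of_prop12Printed abs_H_zero_le)
open BIJ88Sect2SigmaAllTori (exists_gradB_allTori_of_prop12Printed)
open BIJ85Prop12PerTower (prop12Printed_levStd_deltaA)
-- inside this namespace the bare `Site`/`Plaq` are the `ℤ^d` carriers of the QFT root; the torus ones are renamed:
open Balaban1983to89 renaming Site → TSite, Plaq → TPlaq

noncomputable section

/-! ## §1  Per torus, no hypothesis -/

section PerTower

variable {P : Params}

/-- **(2.23) ON EVERY TORUS FOR THE `C_k` OF RECORD, NO HYPOTHESIS** (`d ≥ 2`): `∃ R₀ c₀ δ′, 0 < δ′ ∧ 0 ≤ c₀ ∧ ∀ k ≤ m + K, ∀ x b′,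
R₀ ≤ dist(x,b′) → |C_k(x,b′)| ≤ c₀e^{−δ′dist(x,b′)}` — p08 g8's `decay223_Ck_torus_prop12` with its `h12` discharged by p16's
`prop12Printed_levStd_deltaA` (constants per torus; typing note G-C1-07). [cite: BalabanImbrieJaffe1988, (2.23) p.262] -/
theorem decay223_Ck_torus (hd : 2 ≤ P.d) {a : ℝ} (ha : 0 < a) :
    ∃ R₀ c₀ δ' : ℝ, 0 < δ' ∧ 0 ≤ c₀ ∧ ∀ (k : ℕ) (_ : k ≤ P.m + P.K) (x : TSite P 0) (b' : PBond P k),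
      R₀ ≤ distEU P k x b'.src →
        |CkE P hd ((P.eta k) ^ P.d) ((P.L : ℝ) ^ k) k (toEj P k (Pi.single b' 1)) x| ≤
          c₀ * Real.exp (-δ' * distEU P k x b'.src) :=
  decay223_Ck_torus_prop12 hd ha (prop12Printed_levStd_deltaA P a)

/-- r18's one-letter row shape `DecayFar (κ·dist) C_k c` on every torus, NO HYPOTHESIS (rescaled distance, ONE `(κ, c)` for all
`k ≤ m + K`). [cite: BalabanImbrieJaffe1988, (2.23) p.262] -/
theorem decayFar223_Ck_torus (hd : 2 ≤ P.d) {a : ℝ} (ha : 0 < a) :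
    ∃ κ c : ℝ, 0 < κ ∧ 0 < c ∧ ∀ (k : ℕ) (_ : k ≤ P.m + P.K),
      DecayFar (fun (x : TSite P 0) (b' : PBond P k) => κ * distEU P k x b'.src)
        (fun x b' => CkE P hd ((P.eta k) ^ P.d) ((P.L : ℝ) ^ k) k (toEj P k (Pi.single b' 1)) x) c :=
  decayFar223_Ck_torus_prop12 hd ha (prop12Printed_levStd_deltaA P a)

/-- **(2.25) «Then C_{k,loc} also satisfies (2.23)» ON EVERY TORUS, NO HYPOTHESIS** (`C_{k,loc} = loc ζ′_k C_k`, `ζ′_k = cutoff (r/4) (r/2) dist`,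
every radius `r`). [cite: BalabanImbrieJaffe1988, (2.25) p.262] -/
theorem decay223_CkLoc_torus (hd : 2 ≤ P.d) {a : ℝ} (ha : 0 < a) :
    ∃ R₀ c₀ δ' : ℝ, 0 < δ' ∧ 0 ≤ c₀ ∧ ∀ (k : ℕ) (_ : k ≤ P.m + P.K) (r : ℝ) (x : TSite P 0) (b' : PBond P k),
      R₀ ≤ distEU P k x b'.src →
        |loc (cutoff (r / 4) (r / 2) fun (x : TSite P 0) (b' : PBond P k) => distEU P k x b'.src)
            (fun x b' => CkE P hd ((P.eta k) ^ P.d) ((P.L : ℝ) ^ k) k (toEj P k (Pi.single b' 1)) x) x b'| ≤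
          c₀ * Real.exp (-δ' * distEU P k x b'.src) :=
  decay223_CkLoc_torus_prop12 hd ha (prop12Printed_levStd_deltaA P a)

/-- **(2.26) ON EVERY TORUS, NO HYPOTHESIS**: `∃ R₀ c₀ δ′, 0 < δ′ ∧ 0 ≤ c₀ ∧ ∀ k ≤ m + K, ∀ r ≥ 4R₀, Close dist C_{k,loc} C_k (c₀e^{−(δ′/2)(r/4)}) (δ′/2)`.
[cite: BalabanImbrieJaffe1988, (2.26) p.262] -/
theorem close226_torus (hd : 2 ≤ P.d) {a : ℝ} (ha : 0 < a) :
    ∃ R₀ c₀ δ' : ℝ, 0 < δ' ∧ 0 ≤ c₀ ∧ ∀ (k : ℕ) (_ : k ≤ P.m + P.K) (r : ℝ), 4 * R₀ ≤ r →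
      Close (fun (x : TSite P 0) (b' : PBond P k) => distEU P k x b'.src)
        (loc (cutoff (r / 4) (r / 2) fun (x : TSite P 0) (b' : PBond P k) => distEU P k x b'.src)
          (fun x b' => CkE P hd ((P.eta k) ^ P.d) ((P.L : ℝ) ^ k) k (toEj P k (Pi.single b' 1)) x))
        (fun x b' => CkE P hd ((P.eta k) ^ P.d) ((P.L : ℝ) ^ k) k (toEj P k (Pi.single b' 1)) x)
        (c₀ * Real.exp (-(δ' / 2) * (r / 4))) (δ' / 2) :=
  close226_torus_prop12 hd ha (prop12Printed_levStd_deltaA P a)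

/-- row C2.Eq2.26's typed one-letter shape on every torus, NO HYPOTHESIS (rescaled distance `κ·dist`, ONE `(κ, c)`).
[cite: BalabanImbrieJaffe1988, (2.26) p.262] -/
theorem close226_torus_typed (hd : 2 ≤ P.d) {a : ℝ} (ha : 0 < a) :
    ∃ κ c : ℝ, 0 < κ ∧ 0 < c ∧ ∀ (k : ℕ) (_ : k ≤ P.m + P.K) (r : ℝ), 0 < r → c ≤ r / 4 →
      Close (fun (x : TSite P 0) (b' : PBond P k) => κ * distEU P k x b'.src)
        (loc (cutoff (r / 4) (r / 2) fun (x : TSite P 0) (b' : PBond P k) => κ * distEU P k x b'.src)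
          (fun x b' => CkE P hd ((P.eta k) ^ P.d) ((P.L : ℝ) ^ k) k (toEj P k (Pi.single b' 1)) x))
        (fun x b' => CkE P hd ((P.eta k) ^ P.d) ((P.L : ℝ) ^ k) k (toEj P k (Pi.single b' 1)) x)
        (c * Real.exp (-(c / 2) * (r / 4))) (c / 2) :=
  close226_torus_prop12_typed hd ha (prop12Printed_levStd_deltaA P a)

end PerTower

/-! ## §2  Over all tori, constants before the torus -/

section AllTori

/-- `0 < L^n` on a torus. [folklore] -/
private theorem cast_pow_L_pos' {P : Params} (n : ℕ) : (0 : ℝ) < (P.L : ℝ) ^ n := pow_pos P.cast_L_pos n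

/-- weakening a kernel bound to a larger prefactor and a smaller rate. [folklore] -/
private theorem weaken {M₁ M δ₁ δ t : ℝ} (hM₁ : 0 ≤ M₁) (hM : M₁ ≤ M) (hδ : δ ≤ δ₁) (ht : 0 ≤ t) :
    M₁ * Real.exp (-(δ₁ * t)) ≤ M * Real.exp (-(δ * t)) :=
  mul_le_mul hM (Real.exp_le_exp.2 (by nlinarith)) (Real.exp_pos _).le (hM₁.trans hM)

/-- **ONE `(δ, M)` FOR THE SUP AND THE GRADIENT MEMBER OF (7.2.2) ON EVERY TORUS AND EVERY SCALE `j ≤ m + K`** (scale `0` included: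
`H_0 = I`), from the all-tori [6I] Prop. 1.2 — p16's `exists_absH_le_allTori_of_prop12Printed` / `abs_H_zero_le` and
`exists_gradB_allTori_of_prop12Printed` merged at `δ = min`, `M = max`. [cite: BalabanImbrieJaffe1985, (7.2.2) p.325] -/
theorem exists_HB_allTori_of_prop12Printed {d L : ℕ} (hd : 1 ≤ d) (hL : Odd L ∧ 1 < L) {a : ℝ} (ha : 0 < a)
    (h12 : B5.Prop12Printed (fun i : {x : Params × ℕ // x.1.d = d ∧ x.1.L = L ∧ 1 ≤ x.2 ∧ x.2 ≤ x.1.m + x.1.K} =>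
      settingOf (torusRep i.1.1 i.1.2 (deltaAData i.2.2.2.2 a)) i.1.2)) :
    ∃ δ M : ℝ, 0 < δ ∧ 1 ≤ M ∧ ∀ (P : Params) (_ : P.d = d) (_ : P.L = L) (j : ℕ) (hj : j ≤ P.m + P.K)
      (μ ν : Fin P.d) (x : TSite P 0) (y : TSite P j),
      |(torusRep P j (deltaAData hj a)).H (x, μ) (y, ν)| ≤ M * Real.exp (-(δ * distEU P j x y)) ∧
      ‖fun lam : Fin P.d => (P.L : ℝ) ^ j *
          ((torusRep P j (deltaAData hj a)).H (x.shift lam, μ) (y, ν) - (torusRep P j (deltaAData hj a)).H (x, μ) (y, ν))‖ ≤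
        M * Real.exp (-(δ * distEU P j x y)) := by
  obtain ⟨δ₁, M₁, hδ₁, hM₁, hH⟩ := exists_absH_le_allTori_of_prop12Printed hd hL ha h12
  obtain ⟨δ₂, M₂, hδ₂, hM₂, hB⟩ := exists_gradB_allTori_of_prop12Printed hd hL ha h12
  refine ⟨min δ₁ δ₂, max M₁ M₂, lt_min hδ₁ hδ₂, hM₁.trans (le_max_left _ _), fun P hPd hPL j hj μ ν x y => ⟨?_, ?_⟩⟩
  · have ht : 0 ≤ distEU P j x y := div_nonneg (Nat.cast_nonneg _) (cast_pow_L_pos' j).le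
    rcases Nat.eq_zero_or_pos j with hj0 | hj1
    · subst hj0
      exact abs_H_zero_le hj ha (hM₁.trans (le_max_left _ _)) _ μ ν x y
    · exact (hH P hPd hPL j hj1 hj μ ν x y).trans (weaken (by linarith) (le_max_left _ _) (min_le_left _ _) ht)
  · have ht : 0 ≤ distEU P j x y := div_nonneg (Nat.cast_nonneg _) (cast_pow_L_pos' j).le
    exact (hB P hPd hPL j hj μ ν x y).trans (weaken hM₂ (le_max_right _ _) (min_le_right _ _) ht)

/-- **(2.23) OVER ALL TORI FROM [6I] PROP. 1.2 BY ITS TREE NAME** (`2 ≤ d`, `L` odd `> 1`): ONE `(R₀, c₀, δ′)`, `δ′ > 0`, `c₀ ≥ 0`, with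
`|C_k(x,b′)| ≤ c₀e^{−δ′dist(x,b′)}` whenever `dist(x,b′) ≥ R₀`, for the `C_k` of record `CkE P hd η_k^d L^k k` on EVERY torus `P` (`P.d = d`,
`P.L = L`) and EVERY `k ≤ m + K` — p08 g8's explicit `abs_CkKernel_le` fed with the all-tori sup/gradient members of (7.2.2) and p09's all-tori
(7.2.3): *"a uniform bound |C_k(x,b′)| ≦ ce^{−c dist(x,b′)}, dist(x,b′) > c"*, `c` *"independent of k, T_η"*. [cite: BalabanImbrieJaffe1988, (2.23) p.262] -/
theorem decay223_Ck_allTori_of_prop12Printed {d L : ℕ} (hd : 2 ≤ d) (hL : Odd L ∧ 1 < L) {a : ℝ} (ha : 0 < a)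
    (h12 : B5.Prop12Printed (fun i : {x : Params × ℕ // x.1.d = d ∧ x.1.L = L ∧ 1 ≤ x.2 ∧ x.2 ≤ x.1.m + x.1.K} =>
      settingOf (torusRep i.1.1 i.1.2 (deltaAData i.2.2.2.2 a)) i.1.2)) :
    ∃ R₀ c₀ δ' : ℝ, 0 < δ' ∧ 0 ≤ c₀ ∧ ∀ (P : Params) (_ : P.d = d) (_ : P.L = L) (hdP : 2 ≤ P.d) (k : ℕ) (_ : k ≤ P.m + P.K)
      (x : TSite P 0) (b' : PBond P k), R₀ ≤ distEU P k x b'.src →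
        |CkE P hdP ((P.eta k) ^ P.d) ((P.L : ℝ) ^ k) k (toEj P k (Pi.single b' 1)) x| ≤
          c₀ * Real.exp (-δ' * distEU P k x b'.src) := by
  obtain ⟨δ, M, hδ, hM, hHB⟩ := exists_HB_allTori_of_prop12Printed (le_trans one_le_two hd) hL ha h12
  obtain ⟨MC, δC, hMC, hδC, hC⟩ := ineq723_CE_lt d L hd
  refine ⟨2 * δ / (min δ δC / 2) + 4,
    (d : ℝ) * M * Real.exp δ +
        4 * (Real.exp d * ((d : ℝ) ^ 2 * (2 * (1 + (1:ℝ)⁻¹)) ^ d)) *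
          (2 * (d : ℝ) ^ 3 * M ^ 2 * Real.exp δ * MC *
            (Real.exp (min δ δC / 2 / 2) * ((2 * (1 + d / (min δ δC / 2))) ^ d) ^ 2)) *
          (((d - 2 + 1).factorial : ℝ) / (min δ δC / 2) ^ (d - 2 + 1)),
    min δ δC / 2 / 2, ?_, ?_, fun P hPd hPL hdP k hk x b' hfar => ?_⟩
  · have := lt_min hδ hδC; positivity
  · have := lt_min hδ hδC; positivity
  have hH : ∀ (j : ℕ) (hj : j ≤ P.m + P.K), j ≤ k → ∀ (μ ν : Fin P.d) (x'' : TSite P 0) (y : TSite P j),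
      |(torusRep P j (deltaAData hj a)).H (x'', μ) (y, ν)| ≤ M * Real.exp (-(δ * distEU P j x'' y)) :=
    fun j hj _ μ ν x'' y => (hHB P hPd hPL j hj μ ν x'' y).1
  have hB : ∀ (j : ℕ) (hj : j ≤ P.m + P.K), j < k → ∀ (μ ν : Fin P.d) (x : TSite P 0) (y : TSite P j),
      ‖fun lam : Fin P.d => (P.L : ℝ) ^ j *
          ((torusRep P j (deltaAData hj a)).H (x.shift lam, μ) (y, ν) - (torusRep P j (deltaAData hj a)).H (x, μ) (y, ν))‖ ≤
        M * Real.exp (-(δ * distEU P j x y)) :=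
    fun j hj _ μ ν x y => (hHB P hPd hPL j hj μ ν x y).2
  have hCP : ∀ j < k, ∀ b b'' : PBond P j, |⟪toEj P j (Pi.single b 1),
      CE P ((P.eta j) ^ P.d) ((P.L : ℝ) ^ j) j (toEj P j (Pi.single b'' 1))⟫| ≤
        MC * Real.exp (-(δC * (supDist b.src b''.src : ℝ))) :=
    fun j hjk b b'' => hC P hPd hPL k hk j inferInstance hjk b b''
  subst hPd
  have h := abs_CkKernel_le hdP hk ha hδ hδC (by linarith) hMC.le hH hB hCP hfar
  rw [neg_mul]
  exact h

/-- **r18's one-letter `DecayFar (κ·dist) C_k c` OVER ALL TORI with ONE `(κ, c)`** (`κ, c > 0`), from the all-tori [6I] Prop. 1.2 (p08 g8's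
`decayFar_of_decay3`). [cite: BalabanImbrieJaffe1988, (2.23) p.262] -/
theorem decayFar223_Ck_allTori_of_prop12Printed {d L : ℕ} (hd : 2 ≤ d) (hL : Odd L ∧ 1 < L) {a : ℝ} (ha : 0 < a)
    (h12 : B5.Prop12Printed (fun i : {x : Params × ℕ // x.1.d = d ∧ x.1.L = L ∧ 1 ≤ x.2 ∧ x.2 ≤ x.1.m + x.1.K} =>
      settingOf (torusRep i.1.1 i.1.2 (deltaAData i.2.2.2.2 a)) i.1.2)) :
    ∃ κ c : ℝ, 0 < κ ∧ 0 < c ∧ ∀ (P : Params) (_ : P.d = d) (_ : P.L = L) (hdP : 2 ≤ P.d) (k : ℕ) (_ : k ≤ P.m + P.K),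
      DecayFar (fun (x : TSite P 0) (b' : PBond P k) => κ * distEU P k x b'.src)
        (fun x b' => CkE P hdP ((P.eta k) ^ P.d) ((P.L : ℝ) ^ k) k (toEj P k (Pi.single b' 1)) x) c := by
  obtain ⟨R₀, c₀, δ', hδ', hc₀, h⟩ := decay223_Ck_allTori_of_prop12Printed hd hL ha h12
  have hc0 : 0 < max c₀ 1 := lt_of_lt_of_le one_pos (le_max_right _ _)
  refine ⟨min (δ' / max c₀ 1) (max c₀ 1 / max R₀ 1), max c₀ 1,
    lt_min (div_pos hδ' hc0) (div_pos hc0 (lt_of_lt_of_le one_pos (le_max_right _ _))), hc0, fun P hPd hPL hdP k hk => ?_⟩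
  exact decayFar_of_decay3 hδ' (fun x b' => div_nonneg (Nat.cast_nonneg _) (cast_pow_L_pos' k).le)
    (fun x b' hfar => h P hPd hPL hdP k hk x b' hfar)

/-- **(2.25) «Then C_{k,loc} also satisfies (2.23)» OVER ALL TORI, SAME CONSTANTS** (`C_{k,loc} = loc ζ′_k C_k`, `ζ′_k = cutoff (r/4) (r/2) dist`,
every radius `r`; `0 ≤ ζ′_k ≤ 1`). [cite: BalabanImbrieJaffe1988, (2.25) p.262] -/
theorem decay223_CkLoc_allTori_of_prop12Printed {d L : ℕ} (hd : 2 ≤ d) (hL : Odd L ∧ 1 < L) {a : ℝ} (ha : 0 < a)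
    (h12 : B5.Prop12Printed (fun i : {x : Params × ℕ // x.1.d = d ∧ x.1.L = L ∧ 1 ≤ x.2 ∧ x.2 ≤ x.1.m + x.1.K} =>
      settingOf (torusRep i.1.1 i.1.2 (deltaAData i.2.2.2.2 a)) i.1.2)) :
    ∃ R₀ c₀ δ' : ℝ, 0 < δ' ∧ 0 ≤ c₀ ∧ ∀ (P : Params) (_ : P.d = d) (_ : P.L = L) (hdP : 2 ≤ P.d) (k : ℕ) (_ : k ≤ P.m + P.K)
      (r : ℝ) (x : TSite P 0) (b' : PBond P k), R₀ ≤ distEU P k x b'.src →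
        |loc (cutoff (r / 4) (r / 2) fun (x : TSite P 0) (b' : PBond P k) => distEU P k x b'.src)
            (fun x b' => CkE P hdP ((P.eta k) ^ P.d) ((P.L : ℝ) ^ k) k (toEj P k (Pi.single b' 1)) x) x b'| ≤
          c₀ * Real.exp (-δ' * distEU P k x b'.src) := by
  obtain ⟨R₀, c₀, δ', hδ', hc₀, h⟩ := decay223_Ck_allTori_of_prop12Printed hd hL ha h12
  exact ⟨R₀, c₀, δ', hδ', hc₀, fun P hPd hPL hdP k hk r x b' hfar =>
    decay3_loc (fun x b' => ⟨cutoff_nonneg _ _ _ x b', cutoff_le_one _ _ _ x b'⟩) (fun x b' hxb => h P hPd hPL hdP k hk x b' hxb)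
      x b' hfar⟩

/-- **(2.26) OVER ALL TORI FROM [6I] PROP. 1.2 BY ITS TREE NAME**: ONE `(R₀, c₀, δ′)`, `δ′ > 0`, `c₀ ≥ 0`, such that on EVERY torus
(`P.d = d`, `P.L = L`), for EVERY `k ≤ m + K` and EVERY radius `r ≥ 4R₀`: `Close dist C_{k,loc} C_k (c₀e^{−(δ′/2)(r/4)}) (δ′/2)`, i.e.
`|C_{k,loc}(x,b′) − C_k(x,b′)| ≤ c₀e^{−(δ′/8)r}·e^{−(δ′/2)dist(x,b′)}` for all `x, b′` — the printed `e^{−cr(e_k)}e^{−c dist}` at `r = r(e_k)`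
with `c` *"independent of k, T_η"*. [cite: BalabanImbrieJaffe1988, (2.26) p.262] -/
theorem close226_allTori_of_prop12Printed {d L : ℕ} (hd : 2 ≤ d) (hL : Odd L ∧ 1 < L) {a : ℝ} (ha : 0 < a)
    (h12 : B5.Prop12Printed (fun i : {x : Params × ℕ // x.1.d = d ∧ x.1.L = L ∧ 1 ≤ x.2 ∧ x.2 ≤ x.1.m + x.1.K} =>
      settingOf (torusRep i.1.1 i.1.2 (deltaAData i.2.2.2.2 a)) i.1.2)) :
    ∃ R₀ c₀ δ' : ℝ, 0 < δ' ∧ 0 ≤ c₀ ∧ ∀ (P : Params) (_ : P.d = d) (_ : P.L = L) (hdP : 2 ≤ P.d) (k : ℕ) (_ : k ≤ P.m + P.K)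
      (r : ℝ), 4 * R₀ ≤ r →
      Close (fun (x : TSite P 0) (b' : PBond P k) => distEU P k x b'.src)
        (loc (cutoff (r / 4) (r / 2) fun (x : TSite P 0) (b' : PBond P k) => distEU P k x b'.src)
          (fun x b' => CkE P hdP ((P.eta k) ^ P.d) ((P.L : ℝ) ^ k) k (toEj P k (Pi.single b' 1)) x))
        (fun x b' => CkE P hdP ((P.eta k) ^ P.d) ((P.L : ℝ) ^ k) k (toEj P k (Pi.single b' 1)) x)
        (c₀ * Real.exp (-(δ' / 2) * (r / 4))) (δ' / 2) := by
  obtain ⟨R₀, c₀, δ', hδ', hc₀, h⟩ := decay223_Ck_allTori_of_prop12Printed hd hL ha h12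
  refine ⟨max R₀ 1, c₀, δ', hδ', hc₀, fun P hPd hPL hdP k hk r hr => ?_⟩
  have hr0 : 0 < r := by linarith [le_max_right R₀ 1]
  have hR : R₀ ≤ r / 4 := by linarith [le_max_left R₀ 1]
  exact close_loc_of_decay3 hc₀ hδ'.le hR (isCutoff_cutoff (by linarith) _)
    (fun x b' => ⟨cutoff_nonneg _ _ _ x b', cutoff_le_one _ _ _ x b'⟩) (fun x b' hxb => h P hPd hPL hdP k hk x b' hxb)

end AllTori

end

end Literature.MathematicalPhysics.QuantumFieldTheory.BalabanImbrieJaffe1984to88.BIJ88Decay223CkAllTori
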